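import Literature.NumberTheory.Sieve.FejerSmoothedSign
import HarnessLib

/-!
# Separation of a hyperbolic window `Ylo < mn ≤ Yhi` by archimedean characters `k^{iτ}` — PROVED

Topic `NumberTheory/Sieve` (harmonic analysis on the circle in the elementary, finite form of
`FejerKernelCounting.lean` / `FejerSmoothedSign.lean`, whose Fejér-smoothed indicator
`FejerSmoothing.smoothInd` and its coefficient bound `FejerSmoothing.sum_norm_coef_le` are used).

In bilinear ("Type II") estimates `∑_m ∑_n α_m β_n K(mn)` one often needs the same bound with the
extra SHARP condition `Ylo < mn ≤ Yhi` (a hyperbolic window), at a cost of a logarithm.  The classical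
device (truncated Perron formula / Mellin inversion, e.g. Fouvry–Tenenbaum's "séparation des
variables", or Friedlander–Iwaniec, Ann. of Math. 148 (1998) §20 for the angular analogue formalised
in `FejerSmoothedSign.lean`) is to write the indicator of the window, in the variable `θ = log k`,
as a short trigonometric series: `e(d · log k / V) = k^{2πi d/V}` is completely multiplicative in `k`,
so each harmonic `(mn)^{iτ} = m^{iτ} n^{iτ}` is absorbed into the coefficients `α_m`, `β_n` without
changing their absolute values.  This file PROVES a finite version with explicit constants:

* `fourierChar_mul_log_div`, `smoothInd_log_eq_sum` — with `y = log k / V`, the smoothed indicator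
  `S_H(y)` of `FejerSmoothedSign` is `∑_{n,n' ≤ H+1} γ(n,n') k^{2πi(n−n')/V}`;
* `abs_indicator_sub_smoothInd_le_one`, `abs_indicator_sub_smoothInd_le` — for
  `1 ≤ Ylo ≤ Yhi ≤ e^{V/2}`, `1 ≤ k ≤ e^{V/2}`, `0 < δ ≤ 1/4`:
  `|1_{Ylo < k ≤ Yhi} − S_H(log k / V)| ≤ 1` always, and `≤ 1/(2(H+1)δ)` unless `k` lies in one of
  the two multiplicative strips `Y e^{−δV} < k < Y e^{δV}`, `Y ∈ {Ylo, Yhi}`;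
* `sum_norm_coef_le_two_add_log` — `∑ |γ| ≤ 2 + log(H+1)`;
* `exp_sub_exp_neg_le`, `card_filter_Ioo_le`, `card_filter_mul_mem_Ioo_le`, `card_filter_strip_le`
  — counting the integers of a row `n ↦ mn` inside the strips: `≤ 3δV(Ylo + Yhi)/m + 2`;
* **`sum_norm_windowed_le`**, **`sum_sum_norm_windowed_le`** — the separation inside sums of norms
  of trilinear sums: if every twisted sum `∑_p ‖∑_{s,m,n} m^{iτ} n^{iτ} F_p(s,m,n)‖` is `≤ Bd` and
  `∑_s ‖F_p(s,m,n)‖ ≤ G` pointwise, then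
  `∑_p ‖∑_{s,m,n} 1_{Ylo<mn≤Yhi} F_p(s,m,n)‖ ≤ (2 + log(H+1)) Bd
     + G · #P · ( #B·#C/(2(H+1)δ) + ∑_{m} #{n : mn in a strip} )`.

Design: theorem-only (no new definitions; the kernel is `FejerSmoothing.smoothInd`/`coef`), all
constants explicit, no named facts.  Deliberately NOT here: the optimal (Beurling–Selberg) constants,
smooth (rather than sharp) windows, and the continuous Perron formula.

## References

* J. Friedlander, H. Iwaniec, Ann. of Math. (2) 148 (1998), 945–1040, §20 (separation of variables
  by harmonics, the angular analogue). [FriedlanderIwaniecAnnals1998]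
* H. L. Montgomery, *Ten lectures on the interface between analytic number theory and harmonic
  analysis*, CBMS 84 (1994), Ch. 1 (Fejér kernel).
-/

noncomputable section

open Finset Real
open scoped FourierTransform

namespace Literature.NumberTheory.Sieve.LogWindow

open Literature.NumberTheory.Sieve.FejerSmoothing Literature.NumberTheory.Sieve.FejerCounting

/-! ### The archimedean characters `k ↦ k^{iτ}` -/

/-! The two standard facts `(mn)^s = m^s n^s` (Mathlib `Complex.natCast_mul_natCast_cpow`, tree
`MatomakiRadziwillL4A.natCast_mul_cpow`) and `|k^{iτ}| ≤ 1` (Mathlib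
`Complex.norm_natCast_cpow_of_pos`, tree `MatomakiRadziwillL4A.norm_natCast_cpow_mul_I`) are used
inline below and not restated. -/

/-- `e(d · log k / V) = k^{2πi d / V}` for `k ≥ 1`: the additive characters of `ℝ/ℤ` in the variable
`log k / V` are archimedean characters of `k`. [folklore] -/
theorem fourierChar_mul_log_div {k : ℕ} (hk : k ≠ 0) (d V : ℝ) :
    (𝐞 (d * (Real.log k / V)) : ℂ) = (k : ℂ) ^ (((2 * π * d / V : ℝ) : ℂ) * Complex.I) := by
  rw [Real.fourierChar_apply, Complex.cpow_def_of_ne_zero (by exact_mod_cast hk),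
    ← Complex.natCast_log]
  congr 1
  push_cast
  ring

/-- **The smoothed window as a finite sum of archimedean characters**: with `y = log k / V`,
`S_H(y) = ∑_{n, n' ≤ H+1} γ(n, n') k^{2πi (n − n')/V}`. [folklore] -/
theorem smoothInd_log_eq_sum (H : ℕ) (a b V : ℝ) {k : ℕ} (hk : k ≠ 0) :
    (smoothInd H a b (Real.log k / V) : ℂ) =
      ∑ n ∈ Ioc 0 (H + 1), ∑ n' ∈ Ioc 0 (H + 1),
        coef H a b n n' * (k : ℂ) ^ (((2 * π * ((n : ℝ) - n') / V : ℝ) : ℂ) * Complex.I) := by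
  rw [smoothInd_eq_sum]
  refine sum_congr rfl fun n _ => sum_congr rfl fun n' _ => ?_
  rw [fourierChar_mul_log_div hk]

/-- `∑_{n,n'} |γ(n,n')| ≤ 2 + log(H+1)` when `0 ≤ b − a ≤ 1` (from `sum_norm_coef_le`:
`(b − a) + (2/π)(1 + log(H+1))`, `2/π ≤ 1`). [folklore] -/
theorem sum_norm_coef_le_two_add_log (H : ℕ) {a b : ℝ} (hab : a ≤ b) (hba : b - a ≤ 1) :
    ∑ n ∈ Ioc 0 (H + 1), ∑ n' ∈ Ioc 0 (H + 1), ‖coef H a b n n'‖ ≤ 2 + Real.log (H + 1) := by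
  refine (sum_norm_coef_le H hab).trans ?_
  have hπ : 2 / Real.pi ≤ 1 := by
    rw [div_le_one Real.pi_pos]; linarith [Real.pi_gt_three]
  have hlog : 0 ≤ Real.log (H + 1) := Real.log_nonneg (by norm_cast; omega)
  have h1 : 0 ≤ 1 + Real.log (H + 1) := by linarith
  calc b - a + 2 / Real.pi * (1 + Real.log (H + 1)) ≤ 1 + 1 * (1 + Real.log (H + 1)) := by
        gcongr
    _ = 2 + Real.log (H + 1) := by ring

/-! ### Pointwise comparison of the sharp window with its smoothing -/

/-- `|1_P − S_H(y)| ≤ 1` for any proposition `P` (`0 ≤ S_H ≤ 1` when `0 ≤ b − a ≤ 1`). [folklore] -/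
theorem abs_indicator_sub_smoothInd_le_one (H : ℕ) {a b : ℝ} (hab : a ≤ b) (hba : b - a ≤ 1) (y : ℝ)
    (P : Prop) [Decidable P] :
    |(if P then (1 : ℝ) else 0) - smoothInd H a b y| ≤ 1 := by
  have h0 := smoothInd_nonneg H hab y
  have h1 := smoothInd_le_one H hab hba y
  rw [abs_le]
  split_ifs <;> constructor <;> linarith

/-- **Off the strips the smoothing is exact up to `1/(2(H+1)δ)`**: for `1 ≤ Ylo ≤ Yhi ≤ e^{V/2}`,
`1 ≤ k ≤ e^{V/2}`, `0 < δ ≤ 1/4`, and `k` outside both strips `Y e^{−δV} < k < Y e^{δV}`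
(`Y = Ylo, Yhi`): `|1_{Ylo < k ≤ Yhi} − S_H(log k / V)| ≤ 1/(2(H+1)δ)`, where `S_H` is the smoothed
indicator of `[log Ylo / V, log Yhi / V]`. [folklore] -/
theorem abs_indicator_sub_smoothInd_le {V : ℝ} (hV : 0 < V) (H : ℕ) {δ : ℝ} (hδ : 0 < δ)
    (hδ4 : δ ≤ 1 / 4) {Ylo Yhi : ℝ} (h1 : 1 ≤ Ylo) (hle : Ylo ≤ Yhi) (hhi : Yhi ≤ Real.exp (V / 2))
    {k : ℕ} (hk : 1 ≤ k) (hkV : (k : ℝ) ≤ Real.exp (V / 2))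
    (hlo : ¬(Ylo * Real.exp (-(δ * V)) < k ∧ (k : ℝ) < Ylo * Real.exp (δ * V)))
    (hhi' : ¬(Yhi * Real.exp (-(δ * V)) < k ∧ (k : ℝ) < Yhi * Real.exp (δ * V))) :
    |(if Ylo < (k : ℝ) ∧ (k : ℝ) ≤ Yhi then (1 : ℝ) else 0) -
        smoothInd H (Real.log Ylo / V) (Real.log Yhi / V) (Real.log k / V)| ≤
      1 / (2 * (H + 1) * δ) := by
  set a := Real.log Ylo / V with ha
  set b := Real.log Yhi / V with hb
  set y := Real.log k / V with hy
  have hYlo : 0 < Ylo := by linarith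
  have hYhi : 0 < Yhi := by linarith
  have hk0 : (0 : ℝ) < k := by exact_mod_cast hk
  have hδ2 : δ ≤ 1 / 2 := by linarith
  have heδ : 1 < Real.exp (δ * V) := Real.one_lt_exp_iff.mpr (by positivity)
  have heδ' : Real.exp (-(δ * V)) < 1 := Real.exp_lt_one_iff.mpr (by simp; positivity)
  -- positions on the circle
  have ha0 : 0 ≤ a := div_nonneg (Real.log_nonneg h1) hV.le
  have hab : a ≤ b := div_le_div_of_nonneg_right (Real.log_le_log hYlo hle) hV.le
  have hb2 : b ≤ 1 / 2 := by
    rw [hb, div_le_iff₀ hV]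
    have := Real.log_le_log hYhi hhi
    rw [Real.log_exp] at this
    linarith
  have hy0 : 0 ≤ y := div_nonneg (Real.log_nonneg (by exact_mod_cast hk)) hV.le
  have hy2 : y ≤ 1 / 2 := by
    rw [hy, div_le_iff₀ hV]
    have := Real.log_le_log hk0 hkV
    rw [Real.log_exp] at this
    linarith
  -- translations between multiplicative and additive statements
  have key1 : ∀ {Y : ℝ}, 0 < Y → Y * Real.exp (δ * V) ≤ k → Real.log Y / V + δ ≤ y := by
    intro Y hY h
    have := Real.log_le_log (by positivity) h
    rw [Real.log_mul hY.ne' (Real.exp_pos _).ne', Real.log_exp] at this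
    rw [hy, div_add' _ _ _ hV.ne', div_le_div_iff_of_pos_right hV]
    linarith
  have key2 : ∀ {Y : ℝ}, 0 < Y → (k : ℝ) ≤ Y * Real.exp (-(δ * V)) → y ≤ Real.log Y / V - δ := by
    intro Y hY h
    have := Real.log_le_log hk0 h
    rw [Real.log_mul hY.ne' (Real.exp_pos _).ne', Real.log_exp] at this
    rw [hy, le_sub_iff_add_le, div_add' _ _ _ hV.ne', div_le_div_iff_of_pos_right hV]
    linarith
  have hε0 : 0 ≤ 1 / (2 * ((H : ℝ) + 1) * δ) := by positivity
  by_cases hwin : Ylo < (k : ℝ) ∧ (k : ℝ) ≤ Yhi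
  · -- inside the window and off the strips: deep inside
    rw [if_pos hwin]
    have hk1 : Ylo * Real.exp (δ * V) ≤ k := by
      by_contra h
      push Not at h
      exact hlo ⟨by nlinarith [hwin.1], h⟩
    have hk2 : (k : ℝ) ≤ Yhi * Real.exp (-(δ * V)) := by
      by_contra h
      push Not at h
      exact hhi' ⟨h, by nlinarith [hwin.2]⟩
    have hS := le_smoothInd_of_mem H hδ hδ2 (key1 hYlo hk1) (key2 hYhi hk2)
    have hS1 := smoothInd_le_one H hab (by linarith) y
    rw [abs_le]; constructor <;> linarith
  · rw [if_neg hwin, zero_sub, abs_neg]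
    have hS0 := smoothInd_nonneg H hab y
    rw [abs_of_nonneg hS0]
    rcases le_or_gt (k : ℝ) Ylo with hkle | hkgt
    · -- left of the window: `y ≤ a − δ`, use periodicity at `y + 1`
      have hk2 : (k : ℝ) ≤ Ylo * Real.exp (-(δ * V)) := by
        by_contra h
        push Not at h
        exact hlo ⟨h, by nlinarith⟩
      have hya := key2 hYlo hk2
      have := smoothInd_add_intCast H a b y 1
      push_cast at this
      rw [← this]
      exact smoothInd_le_of_not_mem H hδ hδ2 (by linarith) (by linarith)
    · -- right of the window: `y ≥ b + δ`
      have hkY : Yhi < (k : ℝ) := by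
        by_contra h
        push Not at h
        exact hwin ⟨hkgt, h⟩
      have hk1 : Yhi * Real.exp (δ * V) ≤ k := by
        by_contra h
        push Not at h
        exact hhi' ⟨by nlinarith, h⟩
      have hyb := key1 hYhi hk1
      exact smoothInd_le_of_not_mem H hδ hδ2 hyb (by linarith)

/-! ### Counting integers in the strips -/

/-- `e^u − e^{−u} ≤ 3u` for `0 ≤ u ≤ 1`. [folklore] -/
theorem exp_sub_exp_neg_le {u : ℝ} (h0 : 0 ≤ u) (h1 : u ≤ 1) :
    Real.exp u - Real.exp (-u) ≤ 3 * u := by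
  have h := Real.abs_exp_sub_one_sub_id_le (x := u) (by rw [abs_of_nonneg h0]; exact h1)
  rw [abs_le] at h
  have h2 := Real.add_one_le_exp (-u)
  nlinarith

/-- The number of natural numbers of a finite set in a real interval `(lo, hi)` with `0 ≤ lo ≤ hi` is
at most `hi − lo + 1`. [folklore] -/
theorem card_filter_Ioo_le (C : Finset ℕ) {lo hi : ℝ} (hlo : 0 ≤ lo) (hle : lo ≤ hi) :
    (((C.filter fun n : ℕ => lo < (n : ℝ) ∧ (n : ℝ) < hi).card : ℕ) : ℝ) ≤ hi - lo + 1 := by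
  have hsub : (C.filter fun n : ℕ => lo < (n : ℝ) ∧ (n : ℝ) < hi) ⊆ Ioc ⌊lo⌋₊ ⌊hi⌋₊ := by
    intro n hn
    rw [mem_filter] at hn
    rw [mem_Ioc]
    refine ⟨(Nat.floor_lt hlo).mpr hn.2.1, Nat.le_floor hn.2.2.le⟩
  have hfl : ⌊lo⌋₊ ≤ ⌊hi⌋₊ := Nat.floor_le_floor hle
  calc (((C.filter fun n : ℕ => lo < (n : ℝ) ∧ (n : ℝ) < hi).card : ℕ) : ℝ)
      ≤ ((Ioc ⌊lo⌋₊ ⌊hi⌋₊).card : ℝ) := by exact_mod_cast card_le_card hsub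
    _ = (⌊hi⌋₊ : ℝ) - ⌊lo⌋₊ := by rw [Nat.card_Ioc, Nat.cast_sub hfl]
    _ ≤ hi - lo + 1 := by
        have h1 := Nat.floor_le (hlo.trans hle)
        have h2 := Nat.lt_floor_add_one lo
        linarith

/-- The number of `n` in a finite set with `lo < mn < hi` (`m ≥ 1`, `0 ≤ lo ≤ hi`) is at most
`(hi − lo)/m + 1`. [folklore] -/
theorem card_filter_mul_mem_Ioo_le (C : Finset ℕ) {m : ℕ} (hm : 1 ≤ m) {lo hi : ℝ} (hlo : 0 ≤ lo)
    (hle : lo ≤ hi) :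
    (((C.filter fun n : ℕ => lo < ((m * n : ℕ) : ℝ) ∧ ((m * n : ℕ) : ℝ) < hi).card : ℕ) : ℝ) ≤
      (hi - lo) / m + 1 := by
  have hm0 : (0 : ℝ) < m := by exact_mod_cast hm
  have heq : (C.filter fun n : ℕ => lo < ((m * n : ℕ) : ℝ) ∧ ((m * n : ℕ) : ℝ) < hi) =
      C.filter fun n : ℕ => lo / m < (n : ℝ) ∧ (n : ℝ) < hi / m := by
    refine filter_congr fun n _ => ?_
    push_cast
    rw [div_lt_iff₀' hm0, lt_div_iff₀' hm0]
  rw [heq]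
  refine (card_filter_Ioo_le C (div_nonneg hlo hm0.le) (div_le_div_of_nonneg_right hle hm0.le)).trans ?_
  rw [sub_div]

/-- **Row count of the strips**: for `m ≥ 1`, `0 ≤ Ylo ≤ Yhi`, `0 ≤ δV ≤ 1`, the number of `n` in a
finite set with `mn` in one of the two strips `Y e^{−δV} < mn < Y e^{δV}` (`Y = Ylo, Yhi`) is at most
`3δV (Ylo + Yhi)/m + 2`. [folklore] -/
theorem card_filter_strip_le (C : Finset ℕ) {m : ℕ} (hm : 1 ≤ m) {δ V Ylo Yhi : ℝ} (hYlo : 0 ≤ Ylo)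
    (hYhi : 0 ≤ Yhi) (hδV0 : 0 ≤ δ * V) (hδV1 : δ * V ≤ 1) :
    (((C.filter fun n : ℕ =>
        (Ylo * Real.exp (-(δ * V)) < ((m * n : ℕ) : ℝ) ∧ ((m * n : ℕ) : ℝ) < Ylo * Real.exp (δ * V)) ∨
        (Yhi * Real.exp (-(δ * V)) < ((m * n : ℕ) : ℝ) ∧ ((m * n : ℕ) : ℝ) < Yhi * Real.exp (δ * V))).card
        : ℕ) : ℝ) ≤ 3 * (δ * V) * (Ylo + Yhi) / m + 2 := by
  have hm0 : (0 : ℝ) < m := by exact_mod_cast hm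
  have hexp := exp_sub_exp_neg_le hδV0 hδV1
  have hee : Real.exp (-(δ * V)) ≤ Real.exp (δ * V) := Real.exp_le_exp.mpr (by linarith)
  have hrow : ∀ {Y : ℝ}, 0 ≤ Y →
      (((C.filter fun n : ℕ => Y * Real.exp (-(δ * V)) < ((m * n : ℕ) : ℝ) ∧
          ((m * n : ℕ) : ℝ) < Y * Real.exp (δ * V)).card : ℕ) : ℝ) ≤ 3 * (δ * V) * Y / m + 1 := by
    intro Y hY
    refine (card_filter_mul_mem_Ioo_le C hm (by positivity)
      (mul_le_mul_of_nonneg_left hee hY)).trans ?_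
    rw [← mul_sub]
    have : Y * (Real.exp (δ * V) - Real.exp (-(δ * V))) ≤ 3 * (δ * V) * Y := by nlinarith
    gcongr
  rw [filter_or]
  calc _ ≤ ((((C.filter fun n : ℕ => Ylo * Real.exp (-(δ * V)) < ((m * n : ℕ) : ℝ) ∧
            ((m * n : ℕ) : ℝ) < Ylo * Real.exp (δ * V)).card : ℕ) : ℝ) +
          (((C.filter fun n : ℕ => Yhi * Real.exp (-(δ * V)) < ((m * n : ℕ) : ℝ) ∧
            ((m * n : ℕ) : ℝ) < Yhi * Real.exp (δ * V)).card : ℕ) : ℝ)) := by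
        exact_mod_cast card_union_le _ _
    _ ≤ (3 * (δ * V) * Ylo / m + 1) + (3 * (δ * V) * Yhi / m + 1) := add_le_add (hrow hYlo) (hrow hYhi)
    _ = 3 * (δ * V) * (Ylo + Yhi) / m + 2 := by ring

/-! ### Separation inside sums of norms of trilinear sums -/

/-- Moving a sum over an index `j` out of a triple sum. [folklore] -/
theorem sum_sum_sum_sum_comm {κ : Type*} (J : Finset κ) (A B C : Finset ℕ) (f : ℕ → ℕ → ℕ → κ → ℂ) :
    (∑ s ∈ A, ∑ m ∈ B, ∑ n ∈ C, ∑ j ∈ J, f s m n j) = ∑ j ∈ J, ∑ s ∈ A, ∑ m ∈ B, ∑ n ∈ C, f s m n j := by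
  calc (∑ s ∈ A, ∑ m ∈ B, ∑ n ∈ C, ∑ j ∈ J, f s m n j)
      = ∑ s ∈ A, ∑ m ∈ B, ∑ j ∈ J, ∑ n ∈ C, f s m n j := by
        refine sum_congr rfl fun s _ => sum_congr rfl fun m _ => Finset.sum_comm
    _ = ∑ s ∈ A, ∑ j ∈ J, ∑ m ∈ B, ∑ n ∈ C, f s m n j := by
        refine sum_congr rfl fun s _ => Finset.sum_comm
    _ = ∑ j ∈ J, ∑ s ∈ A, ∑ m ∈ B, ∑ n ∈ C, f s m n j := Finset.sum_comm

/-- `‖∑_s ∑_m ∑_n g‖ ≤ ∑_s ∑_m ∑_n ‖g‖`. [folklore] -/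
theorem norm_sum_sum_sum_le (A B C : Finset ℕ) (g : ℕ → ℕ → ℕ → ℂ) :
    ‖∑ s ∈ A, ∑ m ∈ B, ∑ n ∈ C, g s m n‖ ≤ ∑ s ∈ A, ∑ m ∈ B, ∑ n ∈ C, ‖g s m n‖ :=
  (norm_sum_le _ _).trans (sum_le_sum fun _ _ => (norm_sum_le _ _).trans
    (sum_le_sum fun _ _ => norm_sum_le _ _))

/-- **Separation of the hyperbolic window inside a sum of norms of trilinear sums.**  Let `P` be a
finite index set, `A p`, `B`, `C` finite sets of natural numbers with `B, C ⊂ [1, ∞)` and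
`mn ≤ e^{V/2}` on `B × C`, `F p s m n` complex weights, `1 ≤ Ylo ≤ Yhi ≤ e^{V/2}`, `0 < δ ≤ 1/4`,
`H ∈ ℕ`.  If every archimedean twist satisfies
`∑_p ‖∑_{s ∈ A p} ∑_{m ∈ B} ∑_{n ∈ C} m^{iτ} n^{iτ} F p s m n‖ ≤ Bd` (`τ ∈ ℝ`) and
`∑_{s ∈ A p} ‖F p s m n‖ ≤ G` for all `p, m, n`, then
`∑_p ‖∑_{s,m,n} 1_{Ylo < mn ≤ Yhi} F p s m n‖ ≤ (2 + log(H+1)) Bd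
  + G · #P · ( #B #C / (2(H+1)δ) + ∑_{m ∈ B} #{n ∈ C : mn ∈ strips} )`,
the strips being `Y e^{−δV} < mn < Y e^{δV}`, `Y ∈ {Ylo, Yhi}` (counted by `card_filter_strip_le`).
Proof: `1_{Ylo<k≤Yhi} = S_H(log k/V) + E(k)` with `S_H = ∑ γ(n,n') k^{2πi(n−n')/V}`
(`smoothInd_log_eq_sum`), `∑|γ| ≤ 2 + log(H+1)`, `|E| ≤ 1/(2(H+1)δ)` off the strips and `≤ 1` on
them. [folklore] -/
theorem sum_norm_windowed_le {ι : Type*} (P : Finset ι) (A : ι → Finset ℕ) (B C : Finset ℕ)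
    (F : ι → ℕ → ℕ → ℕ → ℂ) {V : ℝ} (hV : 0 < V) (H : ℕ) {δ : ℝ} (hδ : 0 < δ) (hδ4 : δ ≤ 1 / 4)
    {Ylo Yhi : ℝ} (h1 : 1 ≤ Ylo) (hle : Ylo ≤ Yhi) (hhi : Yhi ≤ Real.exp (V / 2))
    (hB : ∀ m ∈ B, 1 ≤ m) (hC : ∀ n ∈ C, 1 ≤ n)
    (hBC : ∀ m ∈ B, ∀ n ∈ C, ((m * n : ℕ) : ℝ) ≤ Real.exp (V / 2))
    {Bd : ℝ} (hBd : ∀ τ : ℝ, (∑ p ∈ P, ‖∑ s ∈ A p, ∑ m ∈ B, ∑ n ∈ C,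
        (m : ℂ) ^ ((τ : ℂ) * Complex.I) * (n : ℂ) ^ ((τ : ℂ) * Complex.I) * F p s m n‖) ≤ Bd)
    {G : ℝ} (hG : ∀ p ∈ P, ∀ m ∈ B, ∀ n ∈ C, (∑ s ∈ A p, ‖F p s m n‖) ≤ G) :
    (∑ p ∈ P, ‖∑ s ∈ A p, ∑ m ∈ B, ∑ n ∈ C,
        if Ylo < ((m * n : ℕ) : ℝ) ∧ ((m * n : ℕ) : ℝ) ≤ Yhi then F p s m n else 0‖) ≤
      (2 + Real.log (H + 1)) * Bd +
        G * #P * (1 / (2 * (H + 1) * δ) * #B * #C +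
          ∑ m ∈ B, (#(C.filter fun n : ℕ =>
            (Ylo * Real.exp (-(δ * V)) < ((m * n : ℕ) : ℝ) ∧ ((m * n : ℕ) : ℝ) < Ylo * Real.exp (δ * V)) ∨
            (Yhi * Real.exp (-(δ * V)) < ((m * n : ℕ) : ℝ) ∧ ((m * n : ℕ) : ℝ) < Yhi * Real.exp (δ * V)))
            : ℝ)) := by
  classical
  -- the data of the smoothing
  obtain ⟨a, ha⟩ : ∃ a : ℝ, a = Real.log Ylo / V := ⟨_, rfl⟩
  obtain ⟨b, hb⟩ : ∃ b : ℝ, b = Real.log Yhi / V := ⟨_, rfl⟩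
  obtain ⟨ε, hε⟩ : ∃ ε : ℝ, ε = 1 / (2 * ((H : ℝ) + 1) * δ) := ⟨_, rfl⟩
  obtain ⟨J, hJ⟩ : ∃ J : Finset (ℕ × ℕ), J = Ioc 0 (H + 1) ×ˢ Ioc 0 (H + 1) := ⟨_, rfl⟩
  obtain ⟨γ, hγ⟩ : ∃ γ : ℕ × ℕ → ℂ, γ = fun j : ℕ × ℕ => coef H a b j.1 j.2 := ⟨_, rfl⟩
  obtain ⟨ψ, hψ⟩ : ∃ ψ : ℕ × ℕ → ℕ → ℂ, ψ = fun (j : ℕ × ℕ) (k : ℕ) =>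
      (k : ℂ) ^ ((((2 * π * ((j.1 : ℝ) - j.2) / V : ℝ)) : ℂ) * Complex.I) := ⟨_, rfl⟩
  obtain ⟨S, hS⟩ : ∃ S : ℕ → ℝ, S = fun k : ℕ => smoothInd H a b (Real.log k / V) := ⟨_, rfl⟩
  obtain ⟨ind, hind⟩ : ∃ ind : ℕ → ℝ, ind = fun k : ℕ =>
      if Ylo < (k : ℝ) ∧ (k : ℝ) ≤ Yhi then 1 else 0 := ⟨_, rfl⟩
  obtain ⟨str, hstr⟩ : ∃ str : ℕ → ℝ, str = fun k : ℕ =>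
      if (Ylo * Real.exp (-(δ * V)) < (k : ℝ) ∧ (k : ℝ) < Ylo * Real.exp (δ * V)) ∨
        (Yhi * Real.exp (-(δ * V)) < (k : ℝ) ∧ (k : ℝ) < Yhi * Real.exp (δ * V)) then 1 else 0 :=
    ⟨_, rfl⟩
  obtain ⟨T, hT⟩ : ∃ T : ℕ × ℕ → ι → ℂ, T = fun (j : ℕ × ℕ) (p : ι) =>
      ∑ s ∈ A p, ∑ m ∈ B, ∑ n ∈ C, ψ j m * ψ j n * F p s m n := ⟨_, rfl⟩
  have hYlo : 0 < Ylo := by linarith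
  have hYhi : 0 < Yhi := by linarith
  have hab : a ≤ b := by
    rw [ha, hb]; exact div_le_div_of_nonneg_right (Real.log_le_log hYlo hle) hV.le
  have hba : b - a ≤ 1 := by
    have ha0 : 0 ≤ a := by rw [ha]; exact div_nonneg (Real.log_nonneg h1) hV.le
    have hb2 : b ≤ 1 / 2 := by
      rw [hb, div_le_iff₀ hV]
      have := Real.log_le_log hYhi hhi
      rw [Real.log_exp] at this
      linarith
    linarith
  have hε0 : 0 ≤ ε := by rw [hε]; positivity
  have hBd0 : 0 ≤ Bd := le_trans (sum_nonneg fun _ _ => norm_nonneg _) (hBd 0)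
  -- (1) the smoothed window at `k = mn` as a sum of separated characters
  have hSk : ∀ m ∈ B, ∀ n ∈ C, ((S (m * n) : ℝ) : ℂ) = ∑ j ∈ J, γ j * (ψ j m * ψ j n) := by
    intro m hm n hn
    have hk : m * n ≠ 0 := Nat.mul_ne_zero (by linarith [hB m hm]) (by linarith [hC n hn])
    rw [hS, hJ, Finset.sum_product]
    simp only
    rw [smoothInd_log_eq_sum H a b V hk]
    refine sum_congr rfl fun n1 _ => sum_congr rfl fun n2 _ => ?_
    rw [hγ, hψ]
    simp only
    rw [Nat.cast_mul, Complex.natCast_mul_natCast_cpow]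
  -- (2) pointwise decomposition of the summand
  have hpt : ∀ p : ι, ∀ s : ℕ, ∀ m ∈ B, ∀ n ∈ C,
      (if Ylo < ((m * n : ℕ) : ℝ) ∧ ((m * n : ℕ) : ℝ) ≤ Yhi then F p s m n else 0) =
        (∑ j ∈ J, γ j * (ψ j m * ψ j n * F p s m n)) +
          (((ind (m * n) - S (m * n) : ℝ)) : ℂ) * F p s m n := by
    intro p s m hm n hn
    have h0 : (if Ylo < ((m * n : ℕ) : ℝ) ∧ ((m * n : ℕ) : ℝ) ≤ Yhi then F p s m n else 0) =
        ((ind (m * n) : ℝ) : ℂ) * F p s m n := by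
      rw [hind]; simp only; split_ifs <;> simp
    rw [h0, show ((ind (m * n) : ℝ) : ℂ) = ((S (m * n) : ℝ) : ℂ) + (((ind (m * n) - S (m * n) : ℝ)) : ℂ) by
      push_cast; ring, add_mul, hSk m hm n hn, sum_mul]
    congr 1
    refine sum_congr rfl fun j _ => ?_
    ring
  -- (3) the inner sums decompose accordingly
  have hinner : ∀ p : ι,
      (∑ s ∈ A p, ∑ m ∈ B, ∑ n ∈ C,
        if Ylo < ((m * n : ℕ) : ℝ) ∧ ((m * n : ℕ) : ℝ) ≤ Yhi then F p s m n else 0) =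
        (∑ j ∈ J, γ j * T j p) +
          ∑ s ∈ A p, ∑ m ∈ B, ∑ n ∈ C, (((ind (m * n) - S (m * n) : ℝ)) : ℂ) * F p s m n := by
    intro p
    rw [sum_congr rfl fun s _ => sum_congr rfl fun m hm => sum_congr rfl fun n hn => hpt p s m hm n hn]
    simp only [sum_add_distrib]
    congr 1
    rw [sum_sum_sum_sum_comm]
    refine sum_congr rfl fun j _ => ?_
    rw [hT]
    simp only [mul_sum]
  -- (4) the error is small off the strips and bounded on them
  have hstr0 : ∀ k, 0 ≤ str k := by
    intro k; rw [hstr]; simp only; split_ifs <;> norm_num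
  have hE : ∀ m ∈ B, ∀ n ∈ C, |ind (m * n) - S (m * n)| ≤ ε + str (m * n) := by
    intro m hm n hn
    have hk1 : 1 ≤ m * n := Nat.one_le_iff_ne_zero.mpr
      (Nat.mul_ne_zero (by linarith [hB m hm]) (by linarith [hC n hn]))
    have hkV := hBC m hm n hn
    by_cases hs : (Ylo * Real.exp (-(δ * V)) < ((m * n : ℕ) : ℝ) ∧
        ((m * n : ℕ) : ℝ) < Ylo * Real.exp (δ * V)) ∨
        (Yhi * Real.exp (-(δ * V)) < ((m * n : ℕ) : ℝ) ∧ ((m * n : ℕ) : ℝ) < Yhi * Real.exp (δ * V))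
    · have h1' : |ind (m * n) - S (m * n)| ≤ 1 := by
        simp only [hind, hS]
        exact abs_indicator_sub_smoothInd_le_one H hab hba _ _
      have h2' : str (m * n) = 1 := by simp only [hstr]; rw [if_pos hs]
      rw [h2']
      linarith
    · have h2' : str (m * n) = 0 := by simp only [hstr]; rw [if_neg hs]
      rw [h2', add_zero, hε]
      simp only [hind, hS, ha, hb]
      obtain ⟨hs1, hs2⟩ := not_or.mp hs
      exact abs_indicator_sub_smoothInd_le hV H hδ hδ4 h1 hle hhi hk1 hkV hs1 hs2
  -- (5) the error part of one inner sum
  have herr : ∀ p ∈ P,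
      (∑ s ∈ A p, ∑ m ∈ B, ∑ n ∈ C, ‖(((ind (m * n) - S (m * n) : ℝ)) : ℂ) * F p s m n‖) ≤
        G * (ε * #B * #C + ∑ m ∈ B, ∑ n ∈ C, str (m * n)) := by
    intro p hp
    rw [Finset.sum_comm]
    rw [sum_congr rfl fun m _ => Finset.sum_comm]
    have hrow : ∀ m ∈ B, ∀ n ∈ C,
        (∑ s ∈ A p, ‖(((ind (m * n) - S (m * n) : ℝ)) : ℂ) * F p s m n‖) ≤
          G * (ε + str (m * n)) := by
      intro m hm n hn
      have hG0 : 0 ≤ G := le_trans (sum_nonneg fun _ _ => norm_nonneg _) (hG p hp m hm n hn)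
      have hns : ∀ s : ℕ, ‖(((ind (m * n) - S (m * n) : ℝ)) : ℂ) * F p s m n‖ =
          |ind (m * n) - S (m * n)| * ‖F p s m n‖ := fun s => by
        rw [norm_mul, Complex.norm_real, Real.norm_eq_abs]
      rw [sum_congr rfl fun s _ => hns s, ← mul_sum]
      calc |ind (m * n) - S (m * n)| * ∑ s ∈ A p, ‖F p s m n‖
          ≤ (ε + str (m * n)) * G :=
            mul_le_mul (hE m hm n hn) (hG p hp m hm n hn) (sum_nonneg fun _ _ => norm_nonneg _)
              (add_nonneg hε0 (hstr0 _))
        _ = G * (ε + str (m * n)) := mul_comm _ _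
    calc (∑ m ∈ B, ∑ n ∈ C, ∑ s ∈ A p, ‖(((ind (m * n) - S (m * n) : ℝ)) : ℂ) * F p s m n‖)
        ≤ ∑ m ∈ B, ∑ n ∈ C, G * (ε + str (m * n)) :=
          sum_le_sum fun m hm => sum_le_sum fun n hn => hrow m hm n hn
      _ = G * (ε * #B * #C + ∑ m ∈ B, ∑ n ∈ C, str (m * n)) := by
          simp_rw [← mul_sum, sum_add_distrib, sum_const, nsmul_eq_mul]
          ring
  -- the strip indicators count the strip
  have hcount : ∀ m : ℕ, (∑ n ∈ C, str (m * n)) = (#(C.filter fun n : ℕ =>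
      (Ylo * Real.exp (-(δ * V)) < ((m * n : ℕ) : ℝ) ∧ ((m * n : ℕ) : ℝ) < Ylo * Real.exp (δ * V)) ∨
      (Yhi * Real.exp (-(δ * V)) < ((m * n : ℕ) : ℝ) ∧ ((m * n : ℕ) : ℝ) < Yhi * Real.exp (δ * V)))
        : ℝ) := by
    intro m
    rw [natCast_card_filter, hstr]
  -- (6) the main part, summed over `p`
  have hmain : (∑ p ∈ P, ∑ j ∈ J, ‖γ j‖ * ‖T j p‖) ≤ (2 + Real.log (H + 1)) * Bd := by
    rw [Finset.sum_comm]
    have hTj : ∀ j ∈ J, (∑ p ∈ P, ‖T j p‖) ≤ Bd := by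
      intro j _
      have := hBd (2 * π * ((j.1 : ℝ) - j.2) / V)
      rw [hT, hψ]
      exact this
    calc (∑ j ∈ J, ∑ p ∈ P, ‖γ j‖ * ‖T j p‖) = ∑ j ∈ J, ‖γ j‖ * ∑ p ∈ P, ‖T j p‖ := by
          simp_rw [mul_sum]
      _ ≤ ∑ j ∈ J, ‖γ j‖ * Bd :=
          sum_le_sum fun j hj => mul_le_mul_of_nonneg_left (hTj j hj) (norm_nonneg _)
      _ = (∑ j ∈ J, ‖γ j‖) * Bd := by rw [sum_mul]
      _ ≤ (2 + Real.log (H + 1)) * Bd := by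
          refine mul_le_mul_of_nonneg_right ?_ hBd0
          rw [hJ, hγ, Finset.sum_product]
          exact sum_norm_coef_le_two_add_log H hab hba
  -- (7) assemble
  have hstep : ∀ p ∈ P,
      ‖∑ s ∈ A p, ∑ m ∈ B, ∑ n ∈ C,
          if Ylo < ((m * n : ℕ) : ℝ) ∧ ((m * n : ℕ) : ℝ) ≤ Yhi then F p s m n else 0‖ ≤
        (∑ j ∈ J, ‖γ j‖ * ‖T j p‖) + G * (ε * #B * #C + ∑ m ∈ B, ∑ n ∈ C, str (m * n)) := by
    intro p hp
    rw [hinner p]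
    refine (norm_add_le _ _).trans (add_le_add ?_ ?_)
    · refine (norm_sum_le _ _).trans (le_of_eq ?_)
      exact sum_congr rfl fun j _ => norm_mul _ _
    · exact (norm_sum_sum_sum_le _ _ _ _).trans (herr p hp)
  calc (∑ p ∈ P, ‖∑ s ∈ A p, ∑ m ∈ B, ∑ n ∈ C,
          if Ylo < ((m * n : ℕ) : ℝ) ∧ ((m * n : ℕ) : ℝ) ≤ Yhi then F p s m n else 0‖)
      ≤ ∑ p ∈ P, ((∑ j ∈ J, ‖γ j‖ * ‖T j p‖) +
          G * (ε * #B * #C + ∑ m ∈ B, ∑ n ∈ C, str (m * n))) := sum_le_sum hstep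
    _ = (∑ p ∈ P, ∑ j ∈ J, ‖γ j‖ * ‖T j p‖) +
          G * #P * (ε * #B * #C + ∑ m ∈ B, ∑ n ∈ C, str (m * n)) := by
        rw [sum_add_distrib, sum_const, nsmul_eq_mul]; ring
    _ ≤ (2 + Real.log (H + 1)) * Bd +
          G * #P * (ε * #B * #C + ∑ m ∈ B, ∑ n ∈ C, str (m * n)) := add_le_add hmain le_rfl
    _ = _ := by simp only [hcount, hε, mul_assoc]

/-- **Separation of the hyperbolic window, double outer sum** — `sum_norm_windowed_le` for an outer
sum over pairs `(q, r) ∈ Q × R` written as an iterated sum (the shape of dispersion estimates with a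
dilation modulus `q` and a progression modulus `r`):
`∑_q ∑_r ‖∑_{s,m,n} 1_{Ylo<mn≤Yhi} F‖ ≤ (2 + log(H+1)) Bd + G #Q #R (#B #C/(2(H+1)δ) + ∑_m #{n : mn ∈ strips})`.
[folklore] -/
theorem sum_sum_norm_windowed_le (Q R : Finset ℕ) (A : ℕ → ℕ → Finset ℕ) (B C : Finset ℕ)
    (F : ℕ → ℕ → ℕ → ℕ → ℕ → ℂ) {V : ℝ} (hV : 0 < V) (H : ℕ) {δ : ℝ} (hδ : 0 < δ) (hδ4 : δ ≤ 1 / 4)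
    {Ylo Yhi : ℝ} (h1 : 1 ≤ Ylo) (hle : Ylo ≤ Yhi) (hhi : Yhi ≤ Real.exp (V / 2))
    (hB : ∀ m ∈ B, 1 ≤ m) (hC : ∀ n ∈ C, 1 ≤ n)
    (hBC : ∀ m ∈ B, ∀ n ∈ C, ((m * n : ℕ) : ℝ) ≤ Real.exp (V / 2))
    {Bd : ℝ} (hBd : ∀ τ : ℝ, (∑ q ∈ Q, ∑ r ∈ R, ‖∑ s ∈ A q r, ∑ m ∈ B, ∑ n ∈ C,
        (m : ℂ) ^ ((τ : ℂ) * Complex.I) * (n : ℂ) ^ ((τ : ℂ) * Complex.I) * F q r s m n‖) ≤ Bd)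
    {G : ℝ} (hG : ∀ q ∈ Q, ∀ r ∈ R, ∀ m ∈ B, ∀ n ∈ C, (∑ s ∈ A q r, ‖F q r s m n‖) ≤ G) :
    (∑ q ∈ Q, ∑ r ∈ R, ‖∑ s ∈ A q r, ∑ m ∈ B, ∑ n ∈ C,
        if Ylo < ((m * n : ℕ) : ℝ) ∧ ((m * n : ℕ) : ℝ) ≤ Yhi then F q r s m n else 0‖) ≤
      (2 + Real.log (H + 1)) * Bd +
        G * (#Q * #R) * (1 / (2 * (H + 1) * δ) * #B * #C +
          ∑ m ∈ B, (#(C.filter fun n : ℕ =>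
            (Ylo * Real.exp (-(δ * V)) < ((m * n : ℕ) : ℝ) ∧ ((m * n : ℕ) : ℝ) < Ylo * Real.exp (δ * V)) ∨
            (Yhi * Real.exp (-(δ * V)) < ((m * n : ℕ) : ℝ) ∧ ((m * n : ℕ) : ℝ) < Yhi * Real.exp (δ * V)))
            : ℝ)) := by
  have h := sum_norm_windowed_le (Q ×ˢ R) (fun p : ℕ × ℕ => A p.1 p.2) B C
    (fun p : ℕ × ℕ => F p.1 p.2) hV H hδ hδ4 h1 hle hhi hB hC hBC (Bd := Bd)
    (fun τ => by rw [Finset.sum_product]; exact hBd τ) (G := G)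
    (fun p hp m hm n hn => hG p.1 (Finset.mem_product.1 hp).1 p.2 (Finset.mem_product.1 hp).2 m hm n hn)
  rw [Finset.sum_product, Finset.card_product, Nat.cast_mul] at h
  exact h

end Literature.NumberTheory.Sieve.LogWindow
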